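import Summits.SmoothPoincare4.SmoothPoincare4.Theorems.EntropyRungNoncompactShrinkerGapStubCompactSupportLSIOfLSI
import Summits.SmoothPoincare4.SmoothPoincare4.Theorems.EntropyRungNoncompactShrinkerGapLiWangAllScales
import Literature.Geometry.Riemannian.ShrinkerScalarCurvatureNonnegHolds
import HarnessLib

/-!
# Helper `helper_csLSI_allScales` of line `collapsed-ends-usc` (crux `EntropyRung.NoncompactShrinkerGap`,
# stmt-SmoothPoincare4-10868): the LSI of a complete gradient shrinker at every scale, compact-support form

Registered helper stub S3 of the κ-noncollapsing programme (Perelman's no local collapsing of a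
complete gradient shrinker, brick 2 of route item 16588). On a complete connected normalised
gradient shrinker `(M, g, f)` (`Ric + Hess f = g/2`, `R + |∇f|² = f`, closed `g`-balls compact), for
every `τ > 0` and every smooth compactly supported `w` with `Z = ∫ w² > 0`,
`log((4π)^{-n/2} ∫ e^{-f}) ≤ (∫ (τ(R w² + 4|∇w|²) − w² log w²))/Z + log Z + log (4πτ)^{-n/2} − n`.

PROOF. The `τ = 1` passage of `…StubCompactSupportLSIOfLSI.lean` (`mixture_step_ff`,
`log_le_functional_of_lsi`) with the scale threaded through. Input LSI: Li–Wang 2020, Thm. 1.1,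
DISCHARGED in the tree (`liWang2020_shrinkerLSI_allScales_holds`) — for every smooth `ψ` compatible
at scale `τ` with finite second moment, finite Fisher information and integrable `𝒲`-integrand,
`log Θ ≤ 𝒲(g, ψ, τ)`. It is applied to the mixtures `u_δ = (1−δ) w²/Z + δ e^{-f}/∫e^{-f}`,
`ψ_δ = log (4πτ)^{-n/2} − log u_δ`, whose density at scale `τ` is `u_δ`; the mixture toolkit
(`gradSq_mixture_mul_le`, `mixture_entropy_le`) gives `log Θ ≤ (1−δ) F_τ(w) + δ c' + h(δ)` with a
finite constant `c'` and the mixing entropy `h(δ) → 0`, and `δ → 0` concludes. Integrability of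
`e^{-f}, f e^{-f}, R e^{-f}, |∇f|² e^{-f}`, properness of `f` and `d(p, ·)² ≤ 8f + 50n²` come, as
at `τ = 1`, from `R ≥ 0` (Zhang 2009; DISCHARGED, `shrinkerScalarCurvature_nonneg_holds`) through
Haslhofer–Müller's Lemma 2.1 and Carrillo–Ni's Cor. 2.1. Everything here is proved; no definition
and no named fact is introduced.

## References

* [LiWang2020] Y. Li, B. Wang, Calc. Var. PDE 59 (2020) no. 194, Thm. 1.1 / Prop. 5.9.
* [HaslhoferMuller2011] R. Haslhofer, R. Müller, GAFA 21 (2011) 1091–1116, Lemma 2.1, (2.15)–(2.16).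
* [CarrilloNi2009] J. A. Carrillo, L. Ni, Comm. Anal. Geom. 17 (2009) 721–753, Thm. 1.1, Cor. 2.1.
-/

noncomputable section

-- `Summit.SmoothPoincare4.SmoothPoincare4.…` (summit = problem) trips `dupNamespace` on every decl.
set_option linter.dupNamespace false

open scoped Manifold ContDiff ENNReal NNReal Topology
open MeasureTheory Set Filter
open Literature.Geometry.Lorentzian Literature.Geometry.Riemannian

namespace Summit.SmoothPoincare4.SmoothPoincare4.Theorems.NoncompactShrinkerGapNoncollapsing

open Summit.SmoothPoincare4.SmoothPoincare4.Theorems.NoncompactShrinkerGapCompactSupportLSI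

/-! ## Two real-variable lemmas at scale `τ` -/

/-- **The `𝒲`-integrand of the mixture at scale `τ ≥ 0`, pointwise** (`mixture_integrand_le` with
the scale): from `u = α s² + β e`, `G_ψ u ≤ 4α G_w + β e G_f` and the bound of `mixture_entropy_le`,
`(τ(S + G_ψ) + ψ − m) u ≤ α [τ(S s² + 4 G_w) − s² log s² + (log Z + log A − m − log (1−δ)) s²]
 + β [(τ(S + G_f) + t + c − m) e − (log δ) e]`. [folklore] -/
theorem mixture_integrand_le_scale {S Gψ ψ u s e Gw Gf t α β A Z δ c m τ : ℝ} (hτ : 0 ≤ τ)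
    (hu : u = α * s ^ 2 + β * e) (h1 : Gψ * u ≤ 4 * α * Gw + β * e * Gf)
    (h2 : ψ * u ≤ α * ((Real.log Z - Real.log (1 - δ) + Real.log A) * s ^ 2 -
      s ^ 2 * Real.log (s ^ 2)) + β * (e * (t + c - Real.log δ))) :
    (τ * (S + Gψ) + ψ - m) * u ≤
      α * ((τ * (S * s ^ 2 + 4 * Gw) - s ^ 2 * Real.log (s ^ 2)) +
          (Real.log Z + Real.log A - m - Real.log (1 - δ)) * s ^ 2) +
        β * ((τ * (S + Gf) + (t + c) - m) * e + (-Real.log δ) * e) := by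
  have hSu : S * u = α * (S * s ^ 2) + β * (S * e) := by rw [hu]; ring
  have hnu : m * u = α * (m * s ^ 2) + β * (m * e) := by rw [hu]; ring
  have hW : (τ * (S + Gψ) + ψ - m) * u = τ * (S * u) + τ * (Gψ * u) + ψ * u - m * u := by ring
  have h1' : τ * (Gψ * u) ≤ τ * (4 * α * Gw + β * e * Gf) := mul_le_mul_of_nonneg_left h1 hτ
  rw [hW, hSu, hnu]
  linarith

/-- **The limit `δ → 0` with two constants**: if `c ≤ (1−δ) F + δ c' − (1−δ) log (1−δ) − δ log δ`
for all `0 < δ < 1`, then `c ≤ F` (the right side tends to `F` as `δ → 0⁺`). [folklore] -/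
theorem le_of_forall_mixture_bound₂ {c c' F : ℝ}
    (h : ∀ δ : ℝ, 0 < δ → δ < 1 →
      c ≤ (1 - δ) * F + δ * c' + (Real.negMulLog (1 - δ) + Real.negMulLog δ)) : c ≤ F := by
  have hlim : Tendsto (fun δ : ℝ ↦ δ * (c' - F) + (Real.negMulLog (1 - δ) + Real.negMulLog δ))
      (𝓝 0) (𝓝 0) := by
    simpa using (show Continuous fun δ : ℝ ↦ δ * (c' - F) + (Real.negMulLog (1 - δ) +
      Real.negMulLog δ) by fun_prop).tendsto 0
  have hev : ∀ᶠ δ in 𝓝[>] (0 : ℝ),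
      c - F ≤ δ * (c' - F) + (Real.negMulLog (1 - δ) + Real.negMulLog δ) := by
    filter_upwards [Ioo_mem_nhdsGT (zero_lt_one' ℝ)] with δ hδ
    have := h δ hδ.1 hδ.2
    linarith
  have hfinal : c - F ≤ 0 := ge_of_tendsto (hlim.mono_left nhdsWithin_le_nhds) hev
  linarith

/-! ## The mixture step and the inequality at scale `τ` on a complete shrinker (any dimension) -/

section Shrinker

variable {n : ℕ} {M : Type} [TopologicalSpace M] [T2Space M] [SecondCountableTopology M]
  [ChartedSpace (EuclideanSpace ℝ (Fin n)) M] [IsManifold (𝓡 n) ∞ M] [ConnectedSpace M]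
  [T3Space M] [MeasurableSpace M] [BorelSpace M]

omit [T2Space M] [ConnectedSpace M] in
/-- **The mixture step at scale `τ > 0`** (`mixture_step_ff` with the scale threaded through):
granted `c₀ ≤ 𝒲(g, ψ, τ)` for the smooth `ψ` compatible at scale `τ` of bounded second moment,
finite Fisher information and integrable `𝒲`-integrand, and the data of `mixture_step_ff` with
`log ∫e^{-f} = c − log (4πτ)^{-n/2}`, `∫ (τ(R + |∇f|²) + f + c − n) e^{-f} = c' ∫ e^{-f}`: for
`0 < δ < 1`, `c₀ ≤ (1−δ) F_τ(w) + δ c' − (1−δ) log (1−δ) − δ log δ`, via the mixture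
`u_δ = (1−δ) w²/Z + δ e^{-f}/∫e^{-f}`, `ψ_δ = log (4πτ)^{-n/2} − log u_δ` (density `u_δ` at scale
`τ`, finite Fisher information by `gradSq_mixture_mul_le`). [folklore] -/
theorem mixture_step_scale
    (g : PseudoRiemannianMetric (𝓡 n) ∞ (EuclideanSpace ℝ (Fin n)) (TangentSpace (𝓡 n) : M → Type _))
    [g.HasLeviCivita] {f w : M → ℝ} (hg : g.IsRiemannian) {τ : ℝ} (hτ : 0 < τ)
    (hf : ContMDiff (𝓡 n) 𝓘(ℝ, ℝ) ∞ f) (hw : ContMDiff (𝓡 n) 𝓘(ℝ, ℝ) ∞ w)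
    (hwc : HasCompactSupport w) (hS0 : ∀ x, 0 ≤ g.scalarCurvature x) (hf0 : ∀ x, 0 ≤ f x)
    (hint : Integrable (fun x ↦ Real.exp (-f x)) g.riemVolume)
    (hfint : Integrable (fun x ↦ f x * Real.exp (-f x)) g.riemVolume)
    (hSint : Integrable (fun x ↦ g.scalarCurvature x * Real.exp (-f x)) g.riemVolume)
    (hgradint : Integrable (fun x ↦ g.gradSq f x * Real.exp (-f x)) g.riemVolume)
    {p : M} {K : ℝ} (hD2 : ∀ x, (g.riemEDist p x).toReal ^ 2 ≤ 8 * f x + K)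
    (hDm : Measurable fun x ↦ (g.riemEDist p x).toReal)
    (hZ : 0 < ∫ x, w x ^ 2 ∂g.riemVolume) (hI₀pos : 0 < ∫ x, Real.exp (-f x) ∂g.riemVolume)
    {c₀ c c' : ℝ} (hcA : Real.log (∫ x, Real.exp (-f x) ∂g.riemVolume) =
      c - Real.log ((4 * Real.pi * τ) ^ (-(n : ℝ) / 2)))
    (hLSI : ∀ ψ : M → ℝ, ContMDiff (𝓡 n) 𝓘(ℝ, ℝ) ∞ ψ → g.IsEntropyCompatible ψ τ →
      (∃ o : M, Integrable (fun x ↦ (g.riemEDist o x).toReal ^ 2 * entropyDensity n ψ τ x)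
        g.riemVolume) →
      Integrable (fun x ↦ g.gradSq ψ x * entropyDensity n ψ τ x) g.riemVolume →
      Integrable (fun x ↦ (τ * (g.scalarCurvature x + g.gradSq ψ x) + ψ x - n) *
        entropyDensity n ψ τ x) g.riemVolume →
      c₀ ≤ g.wEntropy g.leviCivita ψ τ)
    (hWf : ∫ x, (τ * (g.scalarCurvature x + g.gradSq f x) + (f x + c) - n) * Real.exp (-f x)
      ∂g.riemVolume = (∫ x, Real.exp (-f x) ∂g.riemVolume) * c')
    {δ : ℝ} (hδ0 : 0 < δ) (hδ1 : δ < 1) :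
    c₀ ≤ (1 - δ) * ((∫ x, (τ * (g.scalarCurvature x * w x ^ 2 + 4 * g.gradSq w x) -
        w x ^ 2 * Real.log (w x ^ 2)) ∂g.riemVolume) / (∫ x, w x ^ 2 ∂g.riemVolume) +
        Real.log (∫ x, w x ^ 2 ∂g.riemVolume) + Real.log ((4 * Real.pi * τ) ^ (-(n : ℝ) / 2)) -
        n) + δ * c' + (Real.negMulLog (1 - δ) + Real.negMulLog δ) := by
  classical
  haveI := CarrilloNi2009_shrinkerLSI.isFiniteMeasureOnCompacts_riemVolume hg
  set vol := g.riemVolume with hvol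
  set I₀ : ℝ := ∫ x, Real.exp (-f x) ∂vol with hI₀
  set A : ℝ := (4 * Real.pi * τ) ^ (-(n : ℝ) / 2) with hA
  set Z : ℝ := ∫ x, w x ^ 2 ∂vol with hZdef
  set J : ℝ := ∫ x, (τ * (g.scalarCurvature x * w x ^ 2 + 4 * g.gradSq w x) -
    w x ^ 2 * Real.log (w x ^ 2)) ∂vol with hJ
  have hApos : 0 < A := entropyNormalisation_pos n hτ
  have h1δ : 0 < 1 - δ := by linarith
  /- continuity and support bookkeeping -/
  have hScont : Continuous fun x ↦ g.scalarCurvature x :=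
    (PseudoRiemannianMetric.contMDiff_scalarCurvature g).continuous
  have hgradcont : ∀ {φ : M → ℝ}, ContMDiff (𝓡 n) 𝓘(ℝ, ℝ) ∞ φ → Continuous (g.gradSq φ) :=
    fun hφ ↦ continuous_innerDual_mvfderiv g (hφ.of_le (by norm_num)) (hφ.of_le (by norm_num))
  have hwcont : Continuous w := hw.continuous
  have hw0 : ∀ x, x ∉ tsupport w → w x = 0 := fun x hx ↦ image_eq_zero_of_notMem_tsupport hx
  have hgw0 : ∀ x, x ∉ tsupport w → g.gradSq w x = 0 := fun x hx ↦
    g.gradSq_eq_zero_of_mvfderiv_eq_zero (mvfderiv_eq_zero_of_notMem_tsupport hx)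
  have intK : ∀ {F : M → ℝ}, Continuous F → (∀ x, x ∉ tsupport w → F x = 0) →
      Integrable F vol := fun hF h0 ↦
    hF.integrable_of_hasCompactSupport (HasCompactSupport.intro hwc h0)
  have hw2i : Integrable (fun x ↦ w x ^ 2) vol :=
    intK (hwcont.pow 2) (fun x hx ↦ by simp [hw0 x hx])
  have hJi : Integrable (fun x ↦ τ * (g.scalarCurvature x * w x ^ 2 + 4 * g.gradSq w x) -
      w x ^ 2 * Real.log (w x ^ 2)) vol :=
    intK ((continuous_const.mul ((hScont.mul (hwcont.pow 2)).add
      (continuous_const.mul (hgradcont hw)))).sub (Real.continuous_mul_log.comp (hwcont.pow 2)))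
      (fun x hx ↦ by simp [hw0 x hx, hgw0 x hx])
  obtain ⟨Cw, hCw⟩ := hwcont.bounded_above_of_compact_support hwc
  have hwsq : ∀ x, w x ^ 2 ≤ Cw ^ 2 := fun x ↦ by
    have h := hCw x
    rw [Real.norm_eq_abs] at h
    have : |w x| ^ 2 ≤ Cw ^ 2 := pow_le_pow_left₀ (abs_nonneg _) h 2
    rwa [sq_abs] at this
  have hE1 : ∀ x, Real.exp (-f x) ≤ 1 := fun x ↦ Real.exp_le_one_iff.2 (by linarith [hf0 x])
  /- the mixture -/
  set α : ℝ := (1 - δ) / Z with hα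
  set β : ℝ := δ / I₀ with hβ
  have hα0 : 0 < α := div_pos h1δ hZ
  have hβ0 : 0 < β := div_pos hδ0 hI₀pos
  set u : M → ℝ := fun x ↦ α * w x ^ 2 + β * Real.exp (-f x) with hu
  set ψ : M → ℝ := fun x ↦ Real.log A - Real.log (u x) with hψ
  have hux : ∀ x, u x = α * w x ^ 2 + β * Real.exp (-f x) := fun x ↦ rfl
  have hψx : ∀ x, ψ x = Real.log A - Real.log (u x) := fun x ↦ rfl
  have hupos : ∀ x, 0 < u x := fun x ↦ by rw [hux]; positivity
  set Umax : ℝ := α * Cw ^ 2 + β with hUmax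
  have hule : ∀ x, u x ≤ Umax := fun x ↦ by
    rw [hux, hUmax]
    have h1 : α * w x ^ 2 ≤ α * Cw ^ 2 := mul_le_mul_of_nonneg_left (hwsq x) hα0.le
    have h2 : β * Real.exp (-f x) ≤ β := by nlinarith [hE1 x]
    linarith
  have hEs : ContMDiff (𝓡 n) 𝓘(ℝ, ℝ) ∞ (fun x ↦ Real.exp (-f x)) :=
    (Real.contDiff_exp.comp contDiff_neg).comp_contMDiff hf
  have hus : ContMDiff (𝓡 n) 𝓘(ℝ, ℝ) ∞ u :=
    (((contMDiff_const (c := α)).mul (hw.mul hw)).add ((contMDiff_const (c := β)).mul hEs)).congr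
      (fun x ↦ by simp only [hux, Pi.add_apply, Pi.mul_apply]; ring)
  have hψs : ContMDiff (𝓡 n) 𝓘(ℝ, ℝ) ∞ ψ := fun x ↦
    (contDiffAt_const.sub (Real.contDiffAt_log.2 (hupos x).ne')).comp_contMDiffAt (hus x)
  have hucont : Continuous u := hus.continuous
  -- the density of `ψ` at scale `τ` is `u`
  have hdens : ∀ x, entropyDensity n ψ τ x = u x := by
    intro x
    rw [entropyDensity_apply, ← hA, hψx, neg_sub, Real.exp_sub, Real.exp_log (hupos x),
      Real.exp_log hApos]
    field_simp
  have intU : ∀ {F : M → ℝ}, Continuous F → Integrable (fun x ↦ F x * Real.exp (-f x)) vol →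
      Integrable (fun x ↦ F x * u x) vol := by
    intro F hF hFe
    have h1 : Integrable (fun x ↦ F x * w x ^ 2) vol :=
      intK (hF.mul (hwcont.pow 2)) (fun x hx ↦ by simp [hw0 x hx])
    exact ((h1.const_mul α).add (hFe.const_mul β)).congr
      (ae_of_all _ fun x ↦ by simp only [hux, Pi.add_apply]; ring)
  have hu_int : Integrable u vol := by
    have := intU continuous_const (F := fun _ ↦ (1 : ℝ)) (by simpa using hint)
    simpa using this
  have hfu : Integrable (fun x ↦ f x * u x) vol := intU hf.continuous hfint
  have hu_one : ∫ x, u x ∂vol = 1 := by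
    simp only [hux]
    rw [integral_add (hw2i.const_mul α) (hint.const_mul β), integral_const_mul,
      integral_const_mul, ← hZdef, ← hI₀, hα, hβ]
    field_simp
    ring
  have hcompat : g.IsEntropyCompatible ψ τ := by
    rw [PseudoRiemannianMetric.isEntropyCompatible_iff, finrank_euclideanSpace_fin]
    simp_rw [hdens]
    exact hu_one
  have h2 : Integrable (fun x ↦ (g.riemEDist p x).toReal ^ 2 * entropyDensity n ψ τ x) vol := by
    simp_rw [hdens]
    have hmaj : Integrable (fun x ↦ 8 * (f x * u x) + K * u x) vol :=
      (hfu.const_mul 8).add (hu_int.const_mul _)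
    refine hmaj.mono' ((hDm.pow_const 2).mul hucont.measurable).aestronglyMeasurable
      (ae_of_all _ fun x ↦ ?_)
    rw [Real.norm_eq_abs, abs_of_nonneg (mul_nonneg (sq_nonneg _) (hupos x).le)]
    nlinarith [hD2 x, (hupos x).le]
  have hG : Integrable (fun x ↦ g.gradSq ψ x * entropyDensity n ψ τ x) vol := by
    simp_rw [hdens]
    have hmaj : Integrable (fun x ↦ 4 * α * g.gradSq w x + β * (g.gradSq f x * Real.exp (-f x)))
        vol := ((intK (hgradcont hw) hgw0).const_mul (4 * α)).add (hgradint.const_mul β)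
    refine hmaj.mono' ((hgradcont hψs).mul hucont).aestronglyMeasurable (ae_of_all _ fun x ↦ ?_)
    rw [Real.norm_eq_abs, abs_of_nonneg (mul_nonneg (g.gradSq_nonneg hg ψ x) (hupos x).le)]
    have h1 : g.gradSq ψ x * u x ≤ 4 * α * g.gradSq w x + β * Real.exp (-f x) * g.gradSq f x :=
      gradSq_mixture_mul_le g hg (hw.mdifferentiableAt (by norm_num))
        (hf.mdifferentiableAt (by norm_num)) (Real.log A) hα0.le hβ0
    linarith
  /- the `𝒲`-integrand and its two-sided bounds -/
  set Wi : M → ℝ := fun x ↦ (τ * (g.scalarCurvature x + g.gradSq ψ x) + ψ x - n) * u x with hWi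
  set K₁ : ℝ := Real.log Z + Real.log A - n - Real.log (1 - δ) with hK₁
  set K₂ : ℝ := -Real.log δ with hK₂
  set Wf : M → ℝ := fun x ↦ (τ * (g.scalarCurvature x + g.gradSq f x) + (f x + c) - n) *
    Real.exp (-f x) with hWf'
  set P : M → ℝ := fun x ↦ (τ * (g.scalarCurvature x * w x ^ 2 + 4 * g.gradSq w x) -
    w x ^ 2 * Real.log (w x ^ 2)) + K₁ * w x ^ 2 with hP
  set Q : M → ℝ := fun x ↦ Wf x + K₂ * Real.exp (-f x) with hQ
  have hWle : ∀ x, Wi x ≤ α * P x + β * Q x := fun x ↦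
    mixture_integrand_le_scale hτ.le (hux x)
      (gradSq_mixture_mul_le g hg (hw.mdifferentiableAt (by norm_num))
        (hf.mdifferentiableAt (by norm_num)) (Real.log A) hα0.le hβ0)
      (mixture_entropy_le hZ hI₀pos hδ0 hδ1 hcA (w x) (f x))
  set L : ℝ := Real.log A - Real.log Umax with hL
  have hψge : ∀ x, L ≤ ψ x := fun x ↦ by
    rw [hψx, hL]
    linarith [Real.log_le_log (hupos x) (hule x)]
  have hWge : ∀ x, (L - n) * u x ≤ Wi x := fun x ↦ by
    have hWx : Wi x = τ * (g.scalarCurvature x * u x) + τ * (g.gradSq ψ x * u x) + ψ x * u x -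
        n * u x := by simp only [hWi]; ring
    rw [hWx]
    nlinarith [mul_nonneg hτ.le (mul_nonneg (hS0 x) (hupos x).le),
      mul_nonneg hτ.le (mul_nonneg (g.gradSq_nonneg hg ψ x) (hupos x).le),
      mul_le_mul_of_nonneg_right (hψge x) (hupos x).le]
  have hWfi : Integrable Wf vol :=
    ((((hSint.add hgradint).const_mul τ).add (hfint.add (hint.const_mul c))).sub
      (hint.const_mul (n : ℝ))).congr
      (ae_of_all _ fun x ↦ by simp only [hWf', Pi.add_apply, Pi.sub_apply]; ring)
  have hPi : Integrable P vol := hJi.add (hw2i.const_mul K₁)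
  have hQi : Integrable Q vol := hWfi.add (hint.const_mul K₂)
  have hPQi : Integrable (fun x ↦ α * P x + β * Q x) vol := (hPi.const_mul α).add (hQi.const_mul β)
  have hWcont : Continuous Wi :=
    (((continuous_const.mul (hScont.add (hgradcont hψs))).add hψs.continuous).sub
      continuous_const).mul hucont
  have hWii : Integrable Wi vol :=
    integrable_of_le_of_le hWcont.aestronglyMeasurable hPQi (hu_int.const_mul _) hWge hWle
  /- the LSI at scale `τ` for `ψ`, and integration of the pointwise bound -/
  have hWhyp : Integrable (fun x ↦ (τ * (g.scalarCurvature x + g.gradSq ψ x) + ψ x - n) *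
      entropyDensity n ψ τ x) vol := by
    simp_rw [hdens]; exact hWii
  have hcW : c₀ ≤ g.wEntropy g.leviCivita ψ τ := hLSI ψ hψs hcompat ⟨p, h2⟩ hG hWhyp
  have hWval : g.wEntropy g.leviCivita ψ τ = ∫ x, Wi x ∂vol := by
    rw [PseudoRiemannianMetric.wEntropy_def, finrank_euclideanSpace_fin]
    simp_rw [PseudoRiemannianMetric.scalarCurvatureWith_leviCivita, hdens]
    rfl
  have hPint : ∫ x, P x ∂vol = J + K₁ * Z := by
    simp only [hP]
    rw [integral_add hJi (hw2i.const_mul K₁), integral_const_mul]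
  have hQint : ∫ x, Q x ∂vol = I₀ * c' + K₂ * I₀ := by
    simp only [hQ]
    rw [integral_add hWfi (hint.const_mul K₂), integral_const_mul]
    simp only [hWf']
    rw [hWf]
  have hI : ∫ x, Wi x ∂vol ≤ α * (J + K₁ * Z) + β * (I₀ * c' + K₂ * I₀) := by
    calc ∫ x, Wi x ∂vol ≤ ∫ x, (α * P x + β * Q x) ∂vol := integral_mono hWii hPQi hWle
      _ = α * ∫ x, P x ∂vol + β * ∫ x, Q x ∂vol := by
          rw [integral_add (hPi.const_mul α) (hQi.const_mul β), integral_const_mul,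
            integral_const_mul]
      _ = _ := by rw [hPint, hQint]
  have hαZ : α * (J + K₁ * Z) = (1 - δ) * (J / Z + K₁) := by
    rw [hα]; field_simp
  have hβI : β * (I₀ * c' + K₂ * I₀) = δ * (c' + K₂) := by
    rw [hβ]; field_simp
  rw [hWval] at hcW
  have := hcW.trans hI
  rw [hαZ, hβI, hK₁, hK₂] at this
  simp only [Real.negMulLog]
  linarith

/-- **The LSI of a complete connected normalised gradient shrinker at scale `τ > 0` for compactly
supported test functions**, any dimension: for `w` smooth with compact support and `Z = ∫ w² > 0`,
`log((4π)^{-n/2}∫e^{-f}) ≤ (∫ (τ(R w² + 4|∇w|²) − w² log w²))/Z + log Z + log (4πτ)^{-n/2} − n`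
(`R ≥ 0` ⇒ `f` proper ⇒ weighted integrability; Li–Wang's LSI at scale `τ` feeds
`mixture_step_scale`; `δ → 0`). [cite: LiWang2020, Thm. 1.1 and Prop. 5.9] -/
theorem log_le_functional_scale
    (g : PseudoRiemannianMetric (𝓡 n) ∞ (EuclideanSpace ℝ (Fin n)) (TangentSpace (𝓡 n) : M → Type _))
    [g.HasLeviCivita] (f : M → ℝ) (hg : g.IsRiemannian) {τ : ℝ} (hτ : 0 < τ)
    (hc : ∀ (x : M) (r : NNReal), IsCompact {y : M | g.edist hg x y ≤ r})
    (hf : ContMDiff (𝓡 n) 𝓘(ℝ, ℝ) ∞ f)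
    (hsol : ∀ (x : M) (X Y : TangentSpace (𝓡 n) x),
      g.ricci x X Y + g.hessian f x X Y = (1 / 2 : ℝ) * g.val x X Y)
    (hnorm : ∀ x : M, g.scalarCurvature x + g.gradSq f x = f x)
    {w : M → ℝ} (hw : ContMDiff (𝓡 n) 𝓘(ℝ, ℝ) ∞ w) (hwc : HasCompactSupport w)
    (hZ : 0 < ∫ x, w x ^ 2 ∂g.riemVolume) :
    Real.log ((4 * Real.pi) ^ (-(n : ℝ) / 2) * ∫ x, Real.exp (-f x) ∂g.riemVolume) ≤
      (∫ x, (τ * (g.scalarCurvature x * w x ^ 2 + 4 * g.gradSq w x) - w x ^ 2 * Real.log (w x ^ 2))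
          ∂g.riemVolume) / (∫ x, w x ^ 2 ∂g.riemVolume) + Real.log (∫ x, w x ^ 2 ∂g.riemVolume) +
        Real.log ((4 * Real.pi * τ) ^ (-(n : ℝ) / 2)) - n := by
  classical
  have hS0 : ∀ x, 0 ≤ g.scalarCurvature x :=
    shrinkerScalarCurvature_nonneg_holds n M g f hg hc hf hsol hnorm
  have hLSI := NoncompactShrinkerGapLiWang.liWang2020_shrinkerLSI_allScales_holds n M g f hg
    (fun x r ↦ by simpa only [PseudoRiemannianMetric.riemEDist_eq hg] using hc x r) hf hsol hnorm
    τ hτ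
  /- Haslhofer–Müller's Lemma 2.1 (lower half) given `R ≥ 0` -/
  have hk1 : ((1 : ℕ∞) : ℕ∞ω) + 1 ≤ (∞ : ℕ∞ω) := by
    rw [show ((1 : ℕ∞) : ℕ∞ω) + 1 = 2 by norm_num]
    exact WithTop.coe_le_coe.2 le_top
  haveI : CovariantDerivative.ContMDiffCovariantDerivative g.leviCivita 1 :=
    ⟨g.isLocallyContMDiff_leviCivita_holds 1 hk1 univ isOpen_univ⟩
  haveI : CovariantDerivative.ContMDiffCovariantDerivative g.leviCivita ∞ :=
    ⟨g.isLocallyContMDiff_leviCivita_holds ⊤ (le_of_eq rfl) univ isOpen_univ⟩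
  have hgrad : ∀ x, g.gradSq f x ≤ f x := fun x ↦ by linarith [hS0 x, hnorm x]
  obtain ⟨p, hp⟩ := HaslhoferMuller.exists_forall_potential_le g hg hc hf hgrad hsol
  have hlow : ∀ (x : M) (r : NNReal), (r : ℝ≥0∞) ≤ g.edist hg p x →
      (1 / 4 : ℝ) * (max ((r : ℝ) - 5 * n) 0) ^ 2 ≤ f x := fun x r hr ↦ by
    have h := HaslhoferMuller.potential_lower_of_scalarCurvature_nonneg g hg hc hf hsol hnorm
      hS0 hp x r hr
    rwa [finrank_euclideanSpace_fin] at h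
  /- properness of `f`; weighted integrability of `1, f, R, |∇f|²` -/
  haveI : Nonempty M := ⟨p⟩
  have hprop : ∀ R : ℝ, IsCompact {x | f x ≤ R} := isCompact_sublevel_of_growth hg hf.continuous hc hlow
  obtain ⟨hint, hfint⟩ :=
    CarrilloNi2009_shrinkerLSI.integrable_exp_neg_of_proper hg hf hsol hnorm hprop
  obtain ⟨hSint, hgradint⟩ :=
    CarrilloNi2009_shrinkerLSI.integrable_gradSq_mul_exp_neg_of_proper hg hf hsol hnorm hprop
      (B := 0) (fun x ↦ by rw [neg_zero]; exact hS0 x)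
  set vol := g.riemVolume with hvol
  set I₀ : ℝ := ∫ x, Real.exp (-f x) ∂vol with hI₀
  set A : ℝ := (4 * Real.pi * τ) ^ (-(n : ℝ) / 2) with hA'
  have hI₀pos : 0 < I₀ := pos_of_mul_pos_right (CarrilloNi2009_shrinkerLSI.theta_pos hg hint)
    (Real.rpow_pos_of_pos (by positivity) _).le
  set c : ℝ := Real.log A + Real.log I₀ with hcdef
  have hcA : Real.log I₀ = c - Real.log A := by rw [hcdef]; ring
  have hf0 : ∀ x, 0 ≤ f x := fun x ↦ by linarith [hnorm x, hS0 x, g.gradSq_nonneg hg f x]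
  /- the distance to `p`: `d(p, x)² ≤ 8 f(x) + 50 n²`, measurability -/
  have hD2 : ∀ x, (g.riemEDist p x).toReal ^ 2 ≤ 8 * f x + 2 * (5 * (n : ℝ)) ^ 2 := fun x ↦ by
    have hfin : g.edist hg p x < ⊤ := by
      simpa [PseudoRiemannianMetric.riemEDist_eq hg] using
        CarrilloNi2009_shrinkerLSI.riemEDist_lt_top hg p x
    rw [PseudoRiemannianMetric.riemEDist_eq hg]
    exact toReal_edist_sq_le hg (hlow x) hfin
  have hDm : Measurable fun x ↦ (g.riemEDist p x).toReal := by
    have hcont : Continuous fun x ↦ g.edist hg p x :=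
      (PseudoRiemannianMetric.continuous_edist hg).comp (Continuous.prodMk_right p)
    simp_rw [PseudoRiemannianMetric.riemEDist_eq hg]
    exact hcont.measurable.ennreal_toReal
  set c' : ℝ := (∫ x, (τ * (g.scalarCurvature x + g.gradSq f x) + (f x + c) - n) *
    Real.exp (-f x) ∂vol) / I₀ with hc'def
  have hWf : ∫ x, (τ * (g.scalarCurvature x + g.gradSq f x) + (f x + c) - n) * Real.exp (-f x)
      ∂vol = I₀ * c' := by rw [hc'def, mul_div_cancel₀ _ hI₀pos.ne']
  exact le_of_forall_mixture_bound₂ fun δ hδ0 hδ1 ↦ mixture_step_scale g hg hτ hf hw hwc hS0 hf0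
    hint hfint hSint hgradint hD2 hDm hZ hI₀pos hcA hLSI hWf hδ0 hδ1

end Shrinker

/-! ## The registered stub -/

/-- **Registered helper `helper_csLSI_allScales` (stub S3) of line `collapsed-ends-usc`** — the
logarithmic Sobolev inequality of a complete connected normalised gradient shrinker at every scale
`τ > 0`, in compact-support `𝒲`-form: for smooth compactly supported `w` with `Z = ∫ w² > 0`,
`log((4π)^{-n/2} ∫ e^{-f}) ≤ (∫ (τ(R w² + 4|∇w|²) − w² log w²))/Z + log Z + log (4πτ)^{-n/2} − n`
(Li–Wang 2020 Thm. 1.1 ⇒ mixtures; `log_le_functional_scale`).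
[cite: LiWang2020, Thm. 1.1 and Prop. 5.9] -/
theorem helper_csLSI_allScales : ∀ (n : ℕ) (M : Type) [TopologicalSpace M] [T2Space M] [SecondCountableTopology M] [ChartedSpace (EuclideanSpace ℝ (Fin n)) M] [IsManifold (𝓡 n) ∞ M] [ConnectedSpace M] [T3Space M] [MeasurableSpace M] [BorelSpace M] (g : PseudoRiemannianMetric (𝓡 n) ∞ (EuclideanSpace ℝ (Fin n)) (TangentSpace (𝓡 n) : M → Type _)) [g.HasLeviCivita] (f : M → ℝ) (hg : g.IsRiemannian), (∀ (x : M) (r : NNReal), IsCompact {y : M | g.edist hg x y ≤ r}) → ContMDiff (𝓡 n) 𝓘(ℝ, ℝ) ∞ f → (∀ (x : M) (X Y : TangentSpace (𝓡 n) x), g.ricci x X Y + g.hessian f x X Y = (1 / 2 : ℝ) * g.val x X Y) → (∀ x : M, g.scalarCurvature x + g.gradSq f x = f x) → ∀ τ : ℝ, 0 < τ → ∀ w : M → ℝ, ContMDiff (𝓡 n) 𝓘(ℝ, ℝ) ∞ w → HasCompactSupport w → 0 < ∫ x, w x ^ 2 ∂g.riemVolume → Real.log ((4 * Real.pi) ^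 (-(n : ℝ) / 2) * ∫ x, Real.exp (-f x) ∂g.riemVolume) ≤ (∫ x, (τ * (g.scalarCurvature x * w x ^ 2 + 4 * g.gradSq w x) - w x ^ 2 * Real.log (w x ^ 2)) ∂g.riemVolume) / (∫ x, w x ^ 2 ∂g.riemVolume) + Real.log (∫ x, w x ^ 2 ∂g.riemVolume) + Real.log ((4 * Real.pi * τ) ^ (-(n : ℝ) / 2)) - n := by
  intro n M _ _ _ _ _ _ _ _ _ g _ f hg hc hf hsol hnorm τ hτ w hw hwc hZ
  exact log_le_functional_scale g f hg hτ hc hf hsol hnorm hw hwc hZ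

end Summit.SmoothPoincare4.SmoothPoincare4.Theorems.NoncompactShrinkerGapNoncollapsing

end
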